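import Literature.Barriers.AtomisticToContinuum.OneDimensionalHardCoreLowerBound
import Mathlib.Analysis.PSeries
import HarnessLib

/-!
# Widom's constant for the pure Fisher–Hartwig determinant and Lenard's antipodal law

`Literature/Barriers/AtomisticToContinuum` (D-0021 barrier catalogue, conjunct
`BoseEinsteinCondensation`). Companion of `OneDimensionalHardCore.lean` (the typed sharp law
`OneDimensionalHardCoreSqrt`: `c₀(N)/√N → C > 0`), `OneDimensionalHardCoreToeplitz.lean` (Lenard's
formula `c₀(n+1) = (2π)⁻¹ ∫₀^{2π} R(n,t) dt`, `R(n,t) = D_n(|z-1||z-e^{it}|)`, the Szegő–Lenard bound,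
and `oneDimensionalHardCoreSqrt_of_fisherHartwig`: the typed law from the POINTWISE Fisher–Hartwig
asymptotics `R(n,t)/√n → E |e^{it}-1|^{-1/2}`) and `OneDimensionalHardCoreLowerBound.lean` (the pure
Fisher–Hartwig determinant in closed form, `D_n(|1-e^{iθ}|) = ∏_{k<n} λ_k`, and Lenard's exact
antipodal value `R(n,π) = D_{⌈n/2⌉}(|1-z|) D_{⌊n/2⌋}(|1-z|)`). This file proves, sorry-free:

* **Widom's theorem in the pure case `α = ½`** (`tendsto_pureDet_div_rpow`): the limit
  `κ = lim_{n→∞} D_n(|1 - e^{iθ}|) / n^{1/4}` EXISTS and is positive (`pureFHConst_pos`), with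
  `e^{-3/8} ≤ κ ≤ (4/π) e^{1/8}` (`exp_neg_le_pureFHConst`, `pureFHConst_le`); printed:
  `κ = G(3/2)²/G(2) = G(3/2)² ≈ 1.1431` [DeiftItsKrasovsky2013, §6 (eq84)–(eq85), `m = 0`,
  `α₀ = ½`] (Barnes' `G` is not in Mathlib; the value is recorded, not typed).
* **Lenard's antipodal law** (`tendsto_lenardDet_pi_div_sqrt`), the `t = π` instance of the
  two-zero Fisher–Hartwig asymptotics that `OneDimensionalHardCoreSqrt` needs at every `t`:
  `R(n, π)/√n → κ²/√2 = κ² |e^{iπ} - 1|^{-1/2}` — Widom's two-point formula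
  `D_n(|z-z₁||z-z₂|) ∼ E_{1/2}² |z₁-z₂|^{-2·½·½} √n` [DeiftItsKrasovsky2013, §6 (eq84)–(eq85)] at
  `|z₁ - z₂| = 2`, i.e. Lenard's theorem [Lenard1972, (9)–(10) at `θ = π`, via (42)–(52)]
  (`fisherHartwig_antipodal`: the hypothesis `hpt` of `tendsto_integral_lenardDet_div_sqrt` holds at
  `t = π` with `E = κ²`).

## The argument

With `λ_k = (4/π) W_k (k+1)/(2k+1)` (`pureLam_eq_W`, `W_k` Mathlib's Wallis products) the two-sided
sharp Wallis bounds `(π/2)(4k+1)/(4k+2) ≤ W_k ≤ (π/2)(4k+3)/(4k+4)` (the first is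
`pi_div_two_mul_le_W`; the second, `W_le_pi_div_two_mul`, holds because `W_k (4k+4)/(4k+3)`
INCREASES to `π/2`) give `1 + k/(2k+1)² ≤ λ_k ≤ 1 + 1/(4k+2)`, hence
`|log λ_k - ¼ log((k+1)/k)| ≤ 1/k²` (`abs_pureLogSeq_succ_sub_le`); so
`b_n = log D_{n+1} - ¼ log(n+1)` has summable increments, is Cauchy, and converges; `κ = e^{lim b}`.
The antipodal law is then `R(n,π)/√n = (D_a/a^{1/4})(D_b/b^{1/4}) (a/n)^{1/4} (b/n)^{1/4}` with
`a = ⌈n/2⌉`, `b = ⌊n/2⌋`, `a/n, b/n → 1/2`.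

## References

* [DeiftItsKrasovsky2013] P. Deift, A. Its, I. Krasovsky, Comm. Pure Appl. Math. 66 (2013)
  1360–1438, arXiv:1207.4990: §6 (eq78), (eq84)–(eq85) (Widom's theorem and constant
  `E_α = G(1+α)²/G(1+2α)`), (eqBS) (the pure determinant as a ratio of Barnes functions), Remark 8.
* [Widom1973] H. Widom, Amer. J. Math. 95 (1973) 333–383.
* [Lenard1972] A. Lenard, Pacific J. Math. 42 (1972) 137–145: Theorem (9)–(10) for `θ = π`,
  (42)–(52) (`ρ_∞ = G(3/2)⁴/√2 = πe^{1/2}2^{-1/3}A^{-6}`), conjecture (53) for general `θ`.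
* [ForresterEtAl2003] Forrester–Frankel–Garoni–Witte, Phys. Rev. A 67 (2003) 043607, §2.1.4.

## Design notes

No statement or definition of the statement file is changed and no named fact is introduced (every
`def` has a body; every result is a `theorem`). The one new object, `pureFHConst` (Widom's constant
`κ`, as a `limUnder`), lives in `Literature.Barriers.AtomisticToContinuum.BoseGas`. What is still
missing for `OneDimensionalHardCoreSqrt` itself is the same pointwise law at every `t ∈ (0, 2π)`
(Lenard's conjecture (53) = Widom's theorem for two zeros), of which this file is the case `t = π`.
-/

noncomputable section

open Filter Topology Finset Complex
open Literature.Analysis.Toeplitz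
open scoped BigOperators Real

namespace Literature.Barriers.AtomisticToContinuum.BoseGas

/-! ### The sharp Wallis upper bound and `λ_k ≤ 1 + 1/(4k+2)` -/

section Wallis

open Real.Wallis

/-- The sequence `W_k (4k+4)/(4k+3)` is increasing (its successive ratio is
`4(k+1)(k+2)(4k+3)/((2k+1)(2k+3)(4k+7)) > 1`). [folklore] -/
theorem monotone_W_mul : Monotone fun k : ℕ => W k * ((4 * k + 4) / (4 * k + 3)) := by
  refine monotone_nat_of_le_succ fun k => ?_
  have hW := W_pos k
  rw [W_succ, mul_assoc]
  refine mul_le_mul_of_nonneg_left ?_ hW.le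
  push_cast
  rw [div_mul_div_comm, div_mul_div_comm, div_le_div_iff₀ (by positivity) (by positivity)]
  have key : (2 * (k : ℝ) + 2) * (2 * k + 2) * (4 * (k + 1) + 4) * (4 * k + 3) -
      (4 * k + 4) * ((2 * k + 1) * (2 * k + 3) * (4 * (k + 1) + 3)) = 3 * (4 * k + 4) := by ring
  nlinarith [key]

/-- **A sharp Wallis upper bound**: `W_k ≤ (π/2)(4k+3)/(4k+4)` (Mathlib's `W_le` has `π/2`).
[folklore] -/
theorem W_le_pi_div_two_mul (k : ℕ) : W k ≤ π / 2 * ((4 * k + 3) / (4 * k + 4)) := by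
  have hlim : Tendsto (fun k : ℕ => W k * ((4 * k + 4) / (4 * k + 3))) atTop (𝓝 (π / 2)) := by
    have h1 : Tendsto (fun k : ℕ => ((4 * (k : ℝ) + 4) / (4 * k + 3))) atTop (𝓝 1) := by
      have h : Tendsto (fun k : ℕ => 1 + 1 / (4 * (k : ℝ) + 3)) atTop (𝓝 (1 + 0)) := by
        refine tendsto_const_nhds.add ?_
        refine tendsto_const_nhds.div_atTop ?_
        exact tendsto_atTop_add_const_right _ _
          (tendsto_natCast_atTop_atTop.const_mul_atTop (by norm_num))
      rw [add_zero] at h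
      refine h.congr fun k => ?_
      have : (4 * (k : ℝ) + 3) ≠ 0 := by positivity
      field_simp
      ring
    have := tendsto_W_nhds_pi_div_two.mul h1
    rwa [mul_one] at this
  have hle := monotone_W_mul.ge_of_tendsto hlim k
  have h1 : (0 : ℝ) < 4 * (k : ℝ) + 3 := by positivity
  have h2 : (0 : ℝ) < 4 * (k : ℝ) + 4 := by positivity
  have hid : W k = W k * ((4 * k + 4) / (4 * k + 3)) * ((4 * k + 3) / (4 * k + 4)) := by
    rw [mul_assoc, div_mul_div_comm, mul_comm (4 * (k : ℝ) + 4), div_self (by positivity), mul_one]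
  calc W k = W k * ((4 * k + 4) / (4 * k + 3)) * ((4 * k + 3) / (4 * k + 4)) := hid
    _ ≤ π / 2 * ((4 * k + 3) / (4 * k + 4)) := mul_le_mul_of_nonneg_right hle (by positivity)

/-- **Upper bound for the squared norms**: `λ_k ≤ 1 + 1/(4k+2)`. [folklore] -/
theorem pureLam_le (k : ℕ) : pureLam k ≤ 1 + 1 / (4 * k + 2) := by
  rw [pureLam_eq_W]
  have hW := W_le_pi_div_two_mul k
  have hπ := Real.pi_pos
  have h1 : (0 : ℝ) < 2 * k + 1 := by positivity
  have h2 : (0 : ℝ) < 4 * k + 4 := by positivity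
  have h3 : (0 : ℝ) < 4 * k + 2 := by positivity
  calc 4 / π * W k * ((k + 1) / (2 * k + 1))
      ≤ 4 / π * (π / 2 * ((4 * k + 3) / (4 * k + 4))) * ((k + 1) / (2 * k + 1)) := by gcongr
    _ = 1 + 1 / (4 * k + 2) := by
        field_simp
        ring

/-- Two-sided bounds for `log λ_k`, `k ≥ 1`:
`k/((2k+1)² + k) ≤ log λ_k ≤ 1/(4k+2)`. [folklore] -/
theorem log_pureLam_mem {k : ℕ} (hk : 1 ≤ k) :
    (k : ℝ) / ((2 * k + 1) ^ 2 + k) ≤ Real.log (pureLam k) ∧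
      Real.log (pureLam k) ≤ 1 / (4 * k + 2) := by
  have hpos : 0 < pureLam k := lt_of_lt_of_le one_pos (one_le_pureLam k)
  constructor
  · set u : ℝ := k / (2 * k + 1) ^ 2 with hu
    have hk' : (1 : ℝ) ≤ k := by exact_mod_cast hk
    have hu0 : 0 < u := by positivity
    have h1 : Real.log (1 + u) ≤ Real.log (pureLam k) :=
      Real.log_le_log (by positivity) (pureLam_ge k)
    have h2 : u / (1 + u) ≤ Real.log (1 + u) := by
      have h := Real.log_le_sub_one_of_pos (x := (1 + u)⁻¹) (by positivity)
      rw [Real.log_inv] at h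
      have : (1 + u)⁻¹ - 1 = -(u / (1 + u)) := by field_simp; ring
      rw [this] at h
      linarith
    have h3 : u / (1 + u) = k / ((2 * k + 1) ^ 2 + k) := by
      rw [hu]
      have : (2 * (k : ℝ) + 1) ^ 2 ≠ 0 := by positivity
      field_simp
    rw [← h3]
    linarith
  · calc Real.log (pureLam k) ≤ pureLam k - 1 := Real.log_le_sub_one_of_pos hpos
      _ ≤ 1 / (4 * k + 2) := by linarith [pureLam_le k]

/-- `1/(k+1) ≤ log((k+1)/k) ≤ 1/k` for real `k ≥ 1`. [folklore] -/
theorem log_succ_div_mem {k : ℝ} (hk : 1 ≤ k) :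
    1 / (k + 1) ≤ Real.log ((k + 1) / k) ∧ Real.log ((k + 1) / k) ≤ 1 / k := by
  have hk0 : 0 < k := by linarith
  constructor
  · have h := Real.log_le_sub_one_of_pos (x := k / (k + 1)) (by positivity)
    rw [Real.log_div hk0.ne' (by positivity)] at h
    rw [Real.log_div (by positivity) hk0.ne']
    have : k / (k + 1) - 1 = -(1 / (k + 1)) := by field_simp; ring
    rw [this] at h
    linarith
  · have h := Real.log_le_sub_one_of_pos (x := (k + 1) / k) (by positivity)
    have : (k + 1) / k - 1 = 1 / k := by field_simp; ring
    linarith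

/-- Elementary: the two-sided bounds on `log λ_k` and on `log((k+1)/k)` give
`|log λ_k - ¼ log((k+1)/k)| ≤ 1/k²`. [folklore] -/
theorem abs_sub_quarter_le {k L M : ℝ} (hk : 1 ≤ k)
    (hl1 : k / ((2 * k + 1) ^ 2 + k) ≤ L) (hl2 : L ≤ 1 / (4 * k + 2))
    (hm1 : 1 / (k + 1) ≤ M) (hm2 : M ≤ 1 / k) :
    |L - 1 / 4 * M| ≤ 1 / k ^ 2 := by
  have hk0 : 0 < k := by linarith
  have h1 : 1 / (4 * k) - k / ((2 * k + 1) ^ 2 + k) ≤ 1 / k ^ 2 := by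
    rw [div_sub_div _ _ (by positivity) (by positivity),
      div_le_div_iff₀ (by positivity) (by positivity)]
    nlinarith [mul_pos hk0 hk0, mul_pos (mul_pos hk0 hk0) hk0]
  have h2 : 1 / (4 * k + 2) - 1 / (4 * (k + 1)) ≤ 1 / k ^ 2 := by
    rw [div_sub_div _ _ (by positivity) (by positivity),
      div_le_div_iff₀ (by positivity) (by positivity)]
    nlinarith [mul_pos hk0 hk0]
  have e1 : 1 / (4 * k) = 1 / 4 * (1 / k) := (one_div_mul_one_div 4 k).symm
  have e2 : 1 / (4 * (k + 1)) = 1 / 4 * (1 / (k + 1)) := (one_div_mul_one_div 4 (k + 1)).symm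
  rw [abs_le]
  constructor <;> linarith

/-- Elementary: `log λ_k - ¼ log((k+1)/k) ≤ 1/(8k) - 1/(8(k+1))` (telescoping majorant). [folklore] -/
theorem sub_quarter_le_telescope {k L M : ℝ} (hk : 1 ≤ k) (hl2 : L ≤ 1 / (4 * k + 2))
    (hm1 : 1 / (k + 1) ≤ M) : L - 1 / 4 * M ≤ 1 / (8 * k) - 1 / (8 * (k + 1)) := by
  have hk0 : 0 < k := by linarith
  have h : 1 / (4 * k + 2) - 1 / (4 * (k + 1)) ≤ 1 / (8 * k) - 1 / (8 * (k + 1)) := by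
    rw [div_sub_div _ _ (by positivity) (by positivity),
      div_sub_div _ _ (by positivity) (by positivity),
      div_le_div_iff₀ (by positivity) (by positivity)]
    nlinarith [mul_pos hk0 hk0]
  have e2 : 1 / (4 * (k + 1)) = 1 / 4 * (1 / (k + 1)) := (one_div_mul_one_div 4 (k + 1)).symm
  linarith

end Wallis

/-! ### Widom's constant: `D_n(|1 - e^{iθ}|)/n^{1/4}` converges -/

section PureAsymptotics

/-- The normalised logarithm `b_n = log D_{n+1}(|1-e^{iθ}|) - ¼ log(n+1)`. [folklore] -/
def pureLogSeq (n : ℕ) : ℝ := Real.log (pureDet (n + 1)) - 1 / 4 * Real.log (n + 1)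

/-- `D_{n+1} = D_n λ_n`. [folklore] -/
theorem pureDet_succ (n : ℕ) : pureDet (n + 1) = pureDet n * pureLam n := by
  rw [pureDet_eq_prod, pureDet_eq_prod, prod_range_succ]

/-- The increments of `b_n`: `b_{n+1} - b_n = log λ_{n+1} - ¼ log((n+2)/(n+1))`. [folklore] -/
theorem pureLogSeq_succ_sub (n : ℕ) :
    pureLogSeq (n + 1) - pureLogSeq n =
      Real.log (pureLam (n + 1)) - 1 / 4 * Real.log (((n : ℝ) + 1 + 1) / ((n : ℝ) + 1)) := by
  have hcast : ((n + 1 : ℕ) : ℝ) + 1 = (n : ℝ) + 1 + 1 := by push_cast; ring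
  simp only [pureLogSeq]
  rw [hcast, pureDet_succ (n + 1),
    Real.log_mul (pureDet_pos _).ne' (lt_of_lt_of_le one_pos (one_le_pureLam _)).ne',
    Real.log_div (by positivity) (by positivity)]
  ring

/-- **Summable increments**: `|b_{n+1} - b_n| ≤ 1/(n+1)²`. [folklore] -/
theorem abs_pureLogSeq_succ_sub_le (n : ℕ) :
    |pureLogSeq (n + 1) - pureLogSeq n| ≤ 1 / ((n : ℝ) + 1) ^ 2 := by
  rw [pureLogSeq_succ_sub]
  have h0 : (0 : ℝ) ≤ n := Nat.cast_nonneg _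
  have hk1 : (1 : ℝ) ≤ (n : ℝ) + 1 := by linarith
  obtain ⟨hl1, hl2⟩ := log_pureLam_mem (k := n + 1) (by omega)
  push_cast at hl1 hl2
  obtain ⟨hm1, hm2⟩ := log_succ_div_mem hk1
  exact abs_sub_quarter_le hk1 hl1 hl2 hm1 hm2

/-- `b_n` is a Cauchy sequence. [folklore] -/
theorem cauchySeq_pureLogSeq : CauchySeq pureLogSeq := by
  refine cauchySeq_of_dist_le_of_summable (fun n : ℕ => 1 / ((n : ℝ) + 1) ^ 2) (fun n => ?_) ?_
  · rw [Real.dist_eq, abs_sub_comm]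
    exact abs_pureLogSeq_succ_sub_le n
  · have h : Summable fun n : ℕ => 1 / ((n + 1 : ℕ) : ℝ) ^ 2 :=
      (summable_nat_add_iff 1).2 (Real.summable_one_div_nat_pow.2 one_lt_two)
    refine h.congr fun n => ?_
    push_cast
    ring

/-- **Widom's constant** `κ = lim D_n(|1 - e^{iθ}|)/n^{1/4}` (printed value `G(3/2)² ≈ 1.1431`,
`G` Barnes' function; here the limit of the explicit product `∏_{k<n} λ_k / n^{1/4}`).
[cite: DeiftItsKrasovsky2013, §6 (eq84)–(eq85) with m = 0, α₀ = 1/2] -/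
def pureFHConst : ℝ := limUnder atTop fun n : ℕ => pureDet n / (n : ℝ) ^ (1 / 4 : ℝ)

/-- `D_{n+1}/(n+1)^{1/4} = e^{b_n}`. [folklore] -/
theorem pureDet_succ_div_rpow_eq_exp (n : ℕ) :
    pureDet (n + 1) / ((n : ℝ) + 1) ^ (1 / 4 : ℝ) = Real.exp (pureLogSeq n) := by
  rw [pureLogSeq, Real.exp_sub, Real.exp_log (pureDet_pos _), Real.rpow_def_of_pos (by positivity)]
  congr 1
  rw [mul_comm]

/-- **Widom's theorem, pure case `α = ½`**: `D_n(|1 - e^{iθ}|)/n^{1/4} → κ`.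
[cite: DeiftItsKrasovsky2013, §6 (eq84)–(eq85) with m = 0, α₀ = 1/2] -/
theorem tendsto_pureDet_div_rpow :
    Tendsto (fun n : ℕ => pureDet n / (n : ℝ) ^ (1 / 4 : ℝ)) atTop (𝓝 pureFHConst) := by
  obtain ⟨ℓ, hℓ⟩ := cauchySeq_tendsto_of_complete cauchySeq_pureLogSeq
  have h1 : Tendsto (fun n : ℕ => pureDet (n + 1) / (((n + 1 : ℕ) : ℝ)) ^ (1 / 4 : ℝ)) atTop
      (𝓝 (Real.exp ℓ)) := by
    have h := (Real.continuous_exp.tendsto ℓ).comp hℓ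
    refine h.congr fun n => ?_
    simp only [Function.comp_apply, ← pureDet_succ_div_rpow_eq_exp, Nat.cast_add, Nat.cast_one]
  have h2 : Tendsto (fun n : ℕ => pureDet n / (n : ℝ) ^ (1 / 4 : ℝ)) atTop (𝓝 (Real.exp ℓ)) :=
    (tendsto_add_atTop_iff_nat 1).1 h1
  exact tendsto_nhds_limUnder ⟨_, h2⟩

/-- `κ ≥ e^{-3/8} > 0.68`. [folklore] -/
theorem exp_neg_le_pureFHConst : Real.exp (-(3 / 8)) ≤ pureFHConst := by
  refine ge_of_tendsto tendsto_pureDet_div_rpow ?_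
  filter_upwards [eventually_ge_atTop 1] with n hn
  have hn0 : (0 : ℝ) < n := by exact_mod_cast hn
  have h := pureDet_ge n
  rw [le_div_iff₀ (Real.rpow_pos_of_pos hn0 _)]
  calc Real.exp (-(3 / 8)) * (n : ℝ) ^ (1 / 4 : ℝ)
      ≤ Real.exp (-(3 / 8)) * ((n : ℝ) + 2) ^ (1 / 4 : ℝ) := by
        gcongr
        linarith
    _ ≤ pureDet n := h

/-- **Widom's constant is positive.** [folklore] -/
theorem pureFHConst_pos : 0 < pureFHConst :=
  lt_of_lt_of_le (Real.exp_pos _) exp_neg_le_pureFHConst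

/-- `b_n ≤ b_0 + 1/8 = log(4/π) + 1/8` (the increments telescope below `1/(8k) - 1/(8(k+1))`).
[folklore] -/
theorem pureLogSeq_le (n : ℕ) : pureLogSeq n ≤ Real.log (4 / π) + 1 / 8 := by
  have h0 : pureLogSeq 0 = Real.log (4 / π) := by
    simp [pureLogSeq, pureDet_eq_prod, pureLam_zero]
  have hstep : ∀ m : ℕ, pureLogSeq (m + 1) - pureLogSeq m ≤
      1 / (8 * ((m : ℝ) + 1)) - 1 / (8 * ((m : ℝ) + 1 + 1)) := by
    intro m
    rw [pureLogSeq_succ_sub]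
    have h0' : (0 : ℝ) ≤ m := Nat.cast_nonneg _
    have hk1 : (1 : ℝ) ≤ (m : ℝ) + 1 := by linarith
    obtain ⟨-, hl2⟩ := log_pureLam_mem (k := m + 1) (by omega)
    push_cast at hl2
    obtain ⟨hm1, -⟩ := log_succ_div_mem hk1
    exact sub_quarter_le_telescope hk1 hl2 hm1
  have hsum : ∀ n : ℕ, pureLogSeq n ≤ pureLogSeq 0 + (1 / 8 - 1 / (8 * ((n : ℝ) + 1))) := by
    intro n
    induction n with
    | zero => norm_num
    | succ m ih =>
      have h := hstep m
      push_cast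
      linarith
  have h := hsum n
  have : 0 ≤ 1 / (8 * ((n : ℝ) + 1)) := by positivity
  linarith

/-- `κ ≤ (4/π) e^{1/8} < 1.45`. [folklore] -/
theorem pureFHConst_le : pureFHConst ≤ 4 / π * Real.exp (1 / 8) := by
  have h1 : Tendsto (fun n : ℕ => pureDet (n + 1) / (((n + 1 : ℕ) : ℝ)) ^ (1 / 4 : ℝ)) atTop
      (𝓝 pureFHConst) := (tendsto_add_atTop_iff_nat 1).2 tendsto_pureDet_div_rpow
  refine le_of_tendsto h1 (Eventually.of_forall fun n => ?_)
  have h := pureLogSeq_le n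
  have hc : ((n + 1 : ℕ) : ℝ) = (n : ℝ) + 1 := by push_cast; ring
  calc pureDet (n + 1) / (((n + 1 : ℕ) : ℝ)) ^ (1 / 4 : ℝ) = Real.exp (pureLogSeq n) := by
        rw [hc, pureDet_succ_div_rpow_eq_exp]
    _ ≤ Real.exp (Real.log (4 / π) + 1 / 8) := Real.exp_le_exp.2 h
    _ = 4 / π * Real.exp (1 / 8) := by
        rw [Real.exp_add, Real.exp_log (by positivity)]

/-- **Widom's theorem, pure case, existential form**: `∃ κ > 0, D_n(|1-e^{iθ}|)/n^{1/4} → κ`.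
[cite: DeiftItsKrasovsky2013, §6 (eq84)–(eq85) with m = 0, α₀ = 1/2] -/
theorem exists_tendsto_pureDet_div_rpow :
    ∃ κ : ℝ, 0 < κ ∧ Tendsto (fun n : ℕ => pureDet n / (n : ℝ) ^ (1 / 4 : ℝ)) atTop (𝓝 κ) :=
  ⟨pureFHConst, pureFHConst_pos, tendsto_pureDet_div_rpow⟩

end PureAsymptotics

/-! ### Lenard's antipodal law `R(n, π)/√n → κ²/√2` -/

section Antipodal

/-- Squeeze: if `|u_n - n/2| ≤ 1` then `u_n/n → 1/2`. [folklore] -/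
theorem tendsto_div_nat_of_abs_sub_half_le {u : ℕ → ℝ} (hu : ∀ n : ℕ, |u n - (n : ℝ) / 2| ≤ 1) :
    Tendsto (fun n : ℕ => u n / n) atTop (𝓝 (1 / 2)) := by
  have hlim1 : Tendsto (fun n : ℕ => (1 : ℝ) / 2 - 1 / (n : ℝ)) atTop (𝓝 (1 / 2)) := by
    have h : Tendsto (fun n : ℕ => (1 : ℝ) / 2 - 1 / (n : ℝ)) atTop (𝓝 (1 / 2 - 0)) :=
      tendsto_const_nhds.sub tendsto_one_div_atTop_nhds_zero_nat
    rwa [sub_zero] at h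
  have hlim2 : Tendsto (fun n : ℕ => (1 : ℝ) / 2 + 1 / (n : ℝ)) atTop (𝓝 (1 / 2)) := by
    have h : Tendsto (fun n : ℕ => (1 : ℝ) / 2 + 1 / (n : ℝ)) atTop (𝓝 (1 / 2 + 0)) :=
      tendsto_const_nhds.add tendsto_one_div_atTop_nhds_zero_nat
    rwa [add_zero] at h
  refine tendsto_of_tendsto_of_tendsto_of_le_of_le' hlim1 hlim2 ?_ ?_
  · filter_upwards [eventually_gt_atTop 0] with n hn
    have hn' : (0 : ℝ) < n := by exact_mod_cast hn
    have h := abs_le.1 (hu n)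
    rw [le_div_iff₀ hn']
    have : ((1 : ℝ) / 2 - 1 / (n : ℝ)) * n = n / 2 - 1 := by
      rw [sub_mul, one_div_mul_eq_div, one_div_mul_eq_div, div_self hn'.ne']
    rw [this]
    linarith [h.1]
  · filter_upwards [eventually_gt_atTop 0] with n hn
    have hn' : (0 : ℝ) < n := by exact_mod_cast hn
    have h := abs_le.1 (hu n)
    rw [div_le_iff₀ hn']
    have : ((1 : ℝ) / 2 + 1 / (n : ℝ)) * n = n / 2 + 1 := by
      rw [add_mul, one_div_mul_eq_div, one_div_mul_eq_div, div_self hn'.ne']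
    rw [this]
    linarith [h.2]

/-- `⌊n/2⌋/n → 1/2` along the naturals (as real numbers). [folklore] -/
theorem tendsto_nat_div_two_div :
    Tendsto (fun n : ℕ => ((n / 2 : ℕ) : ℝ) / n) atTop (𝓝 (1 / 2)) := by
  refine tendsto_div_nat_of_abs_sub_half_le fun n => ?_
  have h := Nat.div_add_mod n 2
  have hmod : n % 2 < 2 := Nat.mod_lt _ (by norm_num)
  have hcast : (n : ℝ) = 2 * ((n / 2 : ℕ) : ℝ) + ((n % 2 : ℕ) : ℝ) := by exact_mod_cast h.symm
  have hmod' : ((n % 2 : ℕ) : ℝ) ≤ 1 := by exact_mod_cast Nat.lt_succ_iff.1 hmod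
  have hmod0 : (0 : ℝ) ≤ ((n % 2 : ℕ) : ℝ) := Nat.cast_nonneg _
  rw [abs_le]
  constructor <;> linarith

/-- `⌈n/2⌉/n → 1/2` along the naturals (as real numbers). [folklore] -/
theorem tendsto_nat_succ_div_two_div :
    Tendsto (fun n : ℕ => (((n + 1) / 2 : ℕ) : ℝ) / n) atTop (𝓝 (1 / 2)) := by
  refine tendsto_div_nat_of_abs_sub_half_le fun n => ?_
  have h := Nat.div_add_mod (n + 1) 2
  have hmod : (n + 1) % 2 < 2 := Nat.mod_lt _ (by norm_num)
  have hcast : ((n : ℝ) + 1) = 2 * (((n + 1) / 2 : ℕ) : ℝ) + (((n + 1) % 2 : ℕ) : ℝ) := by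
    exact_mod_cast h.symm
  have hmod' : (((n + 1) % 2 : ℕ) : ℝ) ≤ 1 := by exact_mod_cast Nat.lt_succ_iff.1 hmod
  have hmod0 : (0 : ℝ) ≤ (((n + 1) % 2 : ℕ) : ℝ) := Nat.cast_nonneg _
  rw [abs_le]
  constructor <;> linarith

/-- `⌈n/2⌉ → ∞` (for `⌊n/2⌋ → ∞` see the inline term in `tendsto_lenardDet_pi_div_sqrt`; the
statement `Tendsto (fun n => n / 2) atTop atTop` already exists elsewhere in `Literature`). [folklore] -/
theorem tendsto_nat_succ_div_two_atTop : Tendsto (fun n : ℕ => (n + 1) / 2) atTop atTop :=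
  Filter.tendsto_atTop_atTop.2 fun b => ⟨2 * b, fun n hn => by omega⟩

/-- `(1/2)^{1/4} (1/2)^{1/4} = 2^{-1/2}`. [folklore] -/
theorem half_rpow_quarter_mul_self :
    (1 / 2 : ℝ) ^ (1 / 4 : ℝ) * (1 / 2 : ℝ) ^ (1 / 4 : ℝ) = (2 : ℝ) ^ (-(1 / 2 : ℝ)) := by
  rw [← Real.rpow_add (by norm_num : (0 : ℝ) < 1 / 2), Real.rpow_neg (by norm_num : (0 : ℝ) ≤ 2),
    ← Real.inv_rpow (by norm_num : (0 : ℝ) ≤ 2)]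
  norm_num

/-- **Lenard's antipodal law** (the `t = π` case of Lenard's conjecture / Widom's theorem for two
zeros): `R(n, π)/√n → κ²/√2 = κ² |e^{iπ} - 1|^{-1/2}`, `κ` Widom's constant.
[cite: Lenard1972, Theorem (9)–(10) at θ = π and (42)–(52)] [cite: DeiftItsKrasovsky2013, §6 (eq84)–(eq85)] -/
theorem tendsto_lenardDet_pi_div_sqrt :
    Tendsto (fun n : ℕ => lenardDet n π / Real.sqrt n) atTop
      (𝓝 (pureFHConst ^ 2 * (2 : ℝ) ^ (-(1 / 2 : ℝ)))) := by
  have hFt : Tendsto (fun m : ℕ => pureDet m / (m : ℝ) ^ (1 / 4 : ℝ)) atTop (𝓝 pureFHConst) :=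
    tendsto_pureDet_div_rpow
  have ha : Tendsto (fun n : ℕ => pureDet ((n + 1) / 2) / ((((n + 1) / 2 : ℕ) : ℝ)) ^ (1 / 4 : ℝ))
      atTop (𝓝 pureFHConst) := hFt.comp tendsto_nat_succ_div_two_atTop
  have hdiv : Tendsto (fun n : ℕ => n / 2) atTop atTop :=
    Filter.tendsto_atTop_atTop.2 fun b => ⟨2 * b, fun n hn => by omega⟩
  have hb : Tendsto (fun n : ℕ => pureDet (n / 2) / (((n / 2 : ℕ) : ℝ)) ^ (1 / 4 : ℝ))
      atTop (𝓝 pureFHConst) := hFt.comp hdiv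
  have hc : Tendsto (fun n : ℕ => ((((n + 1) / 2 : ℕ) : ℝ) / n) ^ (1 / 4 : ℝ)) atTop
      (𝓝 ((1 / 2 : ℝ) ^ (1 / 4 : ℝ))) :=
    tendsto_nat_succ_div_two_div.rpow_const (Or.inr (by norm_num))
  have hd : Tendsto (fun n : ℕ => (((n / 2 : ℕ) : ℝ) / n) ^ (1 / 4 : ℝ)) atTop
      (𝓝 ((1 / 2 : ℝ) ^ (1 / 4 : ℝ))) :=
    tendsto_nat_div_two_div.rpow_const (Or.inr (by norm_num))
  have hprod := ((ha.mul hb).mul hc).mul hd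
  rw [show pureFHConst * pureFHConst * (1 / 2 : ℝ) ^ (1 / 4 : ℝ) * (1 / 2 : ℝ) ^ (1 / 4 : ℝ) =
    pureFHConst ^ 2 * (2 : ℝ) ^ (-(1 / 2 : ℝ)) by
      rw [mul_assoc, half_rpow_quarter_mul_self]; ring] at hprod
  refine hprod.congr' ?_
  filter_upwards [eventually_ge_atTop 2] with n hn
  have hn0 : (0 : ℝ) < n := by exact_mod_cast (by omega : 0 < n)
  have ha0 : (0 : ℝ) < (((n + 1) / 2 : ℕ) : ℝ) := by exact_mod_cast (by omega : 0 < (n + 1) / 2)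
  have hb0 : (0 : ℝ) < ((n / 2 : ℕ) : ℝ) := by exact_mod_cast (by omega : 0 < n / 2)
  rw [lenardDet_pi, Real.div_rpow ha0.le hn0.le, Real.div_rpow hb0.le hn0.le, Real.sqrt_eq_rpow]
  have hq : (n : ℝ) ^ (1 / 2 : ℝ) = (n : ℝ) ^ (1 / 4 : ℝ) * (n : ℝ) ^ (1 / 4 : ℝ) := by
    rw [← Real.rpow_add hn0]; norm_num
  rw [hq]
  have h1 : (n : ℝ) ^ (1 / 4 : ℝ) ≠ 0 := (Real.rpow_pos_of_pos hn0 _).ne'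
  have h2 : ((((n + 1) / 2 : ℕ) : ℝ)) ^ (1 / 4 : ℝ) ≠ 0 := (Real.rpow_pos_of_pos ha0 _).ne'
  have h3 : (((n / 2 : ℕ) : ℝ)) ^ (1 / 4 : ℝ) ≠ 0 := (Real.rpow_pos_of_pos hb0 _).ne'
  field_simp

/-- The same limit in the currency of `fhProfile`: `R(n, π)/√n → fhProfile κ² π`
(`= κ² |e^{iπ} - 1|^{-1/2}`), i.e. the pointwise hypothesis `hpt` of
`tendsto_integral_lenardDet_div_sqrt` HOLDS at `t = π` with `E = κ²` — Widom's two-point constant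
`E_{1/2}² |z₁ - z₂|^{-1/2}` at `|z₁ - z₂| = 2`.
[cite: DeiftItsKrasovsky2013, §6 (eq84)–(eq85)] [cite: Lenard1972, (9)–(10), (53)] -/
theorem tendsto_lenardDet_pi_div_sqrt_fhProfile :
    Tendsto (fun n : ℕ => lenardDet n π / Real.sqrt n) atTop
      (𝓝 (fhProfile (pureFHConst ^ 2) π)) := by
  have h : fhProfile (pureFHConst ^ 2) π = pureFHConst ^ 2 * (2 : ℝ) ^ (-(1 / 2 : ℝ)) := by
    rw [fhProfile, Complex.exp_pi_mul_I]
    norm_num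
  rw [h]
  exact tendsto_lenardDet_pi_div_sqrt

end Antipodal

end Literature.Barriers.AtomisticToContinuum.BoseGas

namespace Literature.Barriers.AtomisticToContinuum

open BoseGas Literature.Analysis.Toeplitz

/-- **Fisher–Hartwig asymptotics for two ANTIPODAL zeros** (Lenard 1972; the special case
`e^{iθ₂} = -e^{iθ₁}`, `θ₂ = θ₁ + π`, of the hypothesis `hFH` of
`oneDimensionalHardCoreSqrt_of_fisherHartwig`, in the same currency): there is `E > 0` (`= κ²`, `κ`
Widom's pure constant) with
`D_n(|z - e^{i(θ₁+π)}||z - e^{iθ₁}|)/√n → E |e^{i(θ₁+π)} - e^{iθ₁}|^{-1/2} = E/√2` for every `θ₁`.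
[cite: Lenard1972, Theorem (9)–(10) at θ = π] [cite: DeiftItsKrasovsky2013, §6 (eq84)–(eq85)] -/
theorem fisherHartwig_antipodal :
    ∃ E : ℝ, 0 < E ∧ ∀ θ₁ : ℝ,
      Tendsto (fun n : ℕ =>
          toeplitzDet (circleCoeff (lenardSymbol (θ₁ + π) θ₁)) n / ((Real.sqrt n : ℝ) : ℂ))
        atTop (𝓝 (((E * ‖cexp ((θ₁ + π : ℝ) * I) - cexp (θ₁ * I)‖ ^ (-(1 / 2 : ℝ)) : ℝ) : ℂ))) := by
  refine ⟨pureFHConst ^ 2, pow_pos pureFHConst_pos 2, fun θ₁ => ?_⟩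
  have hexp : cexp ((θ₁ + π : ℝ) * I) = -cexp (θ₁ * I) := by
    push_cast
    rw [add_mul, Complex.exp_add, Complex.exp_pi_mul_I]
    ring
  have hnorm : ‖cexp ((θ₁ + π : ℝ) * I) - cexp (θ₁ * I)‖ = 2 := by
    rw [hexp, show -cexp (θ₁ * I) - cexp (θ₁ * I) = -(2 * cexp (θ₁ * I)) by ring, norm_neg,
      norm_mul, Complex.norm_exp_ofReal_mul_I]
    norm_num
  have hfun : (fun n : ℕ =>
      toeplitzDet (circleCoeff (lenardSymbol (θ₁ + π) θ₁)) n / ((Real.sqrt n : ℝ) : ℂ)) =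
      fun n : ℕ => ((lenardDet n π / Real.sqrt n : ℝ) : ℂ) := by
    funext n
    rw [toeplitzDet_lenardSymbol_eq_lenardDet, show θ₁ + π - θ₁ = π by ring, Complex.ofReal_div]
  rw [hfun, hnorm]
  exact (Complex.continuous_ofReal.tendsto _).comp tendsto_lenardDet_pi_div_sqrt

end Literature.Barriers.AtomisticToContinuum

end
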